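import Summits.QuantumFields.YangMills.Theorems.BalabanUVNodesN22JointChartsRealU1ModelFires

/-!
# BalabanUVNodes ∕ node N22 = NE9 — A6 AT THE ACTIVITY LEVEL FOR THE ANALYTIC ROAD (ROAD 3), part 3∕3: C4 §2 `windowedCouplingHolo_localizedSum` FIRES AT THE REAL U(1)
# MODEL — C2's WINDOWED COUPLING-HOLOMORPHY DATUM `hA` for node00-def-W1's LOCALIZED SUM of activity-level towers that READ the configuration AND every coupling;
# realisation of the towers; the packaged ∃ with admissible numerals

WIDTH SEAT dag-n22-w1 (harness re-seat g5), piece C7 of its own lineage, part 3 (part 1 `…N22JointChartsRealU1Model` p634063 = the model step + realness + the joint chart;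
part 2 `…N22JointChartsRealU1ModelFires` = C6 §2's binders at the towers, C6 §2 fired, the reality binder).  Cell `pub-ymgap`, HUMAN RULING D-0062 (Track A) ∕ D-0149;
`--kind proof --supports stmt-QuantumFields-27366 --as helper` (K3⁸ `SpineGivenEndpointR13SepCoPHV`, KEY MAP v2), COUNT-NEUTRAL.  THEOREMS ONLY (0 `def`, 0 `sorry`, standard
axioms).  Imports part 2 only (through it: C4 `…N22WindowedCouplingHoloOfLocalTerms` p629756 `windowedCouplingHolo_localizedSum`; dag-n22-w2's `norm_ι_single_le`,
`tailWeight_pos`; (C) p607185 `smokeNumerals`).  Nothing re-declared.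

THE CHAIN CLOSED HERE (model level).  ROAD 3 of the N22 row reads, in hypothesis form: activity-level JOINT (young coupling, field) charts with (2.38) [C6 §2] ⇒ per-term
joint OUTPUT charts with the (1.18)-type bound ⇒ [C4 §2, + reality + probe readings with the p. 282 tails + dag-n22-w2's soft two-point summation] the WINDOWED
COUPLING-HOLOMORPHY DATUM `hA` of C2 `…N22KernelFadingOfStepRateTwoConstants` §1 for `ℰ := localizedSum F S emb` ⇒ [C2 §1, with N18's kernel step rate + decay + (1.21)]
`NE9 ∧ FadingMemory`.  Parts 1–2 inhabit C6 §2's antecedent NON-DEGENERATELY by the REAL U(1) MODEL; THIS PART fires C4 §2 on it: the datum `hA` HOLDS for the localized sum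
of an explicit family of towers whose activities read the configuration (`H(Z;g;0) = 0`, `‖H(Z;0;𝟙)‖ > 0`) and every young coupling (cosine phase), at the NON-ZERO chart
`x ↦ ix` with an INJECTIVE complexification — so at this model the datum's content is NOT free (contrast: termless towers, configuration-constant phase towers, zero chart).
The LAST link (C2 §1) is NOT fired here: N18's kernel step rate and (1.21) existence for this model's kernels are def-B's ∕ N18's binders and are not computed.

WHAT (all [folklore]; MODEL level).  §6 ★★★ `windowedCouplingHolo_localizedSum_fires_realU1` — for `M = L^{m′}`, `γ > 0`, field radius = the read-out letter `r > 0`, tails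
`δ₀ > 0`, `B₃ > 0`, `0 ≤ A`, `0 ≤ ω ≤ 1`, soft-sum rate `2κ₀(64,8) ≤ κ ≤ r₁`, Road 1's numerals for `A e^{s}`, disc radius `0 ≤ r₀ < s`: ALL hypotheses of C4 §2 hold at
(`S`, `emb`, `x ↦ ix`, `Basis.singleton`, `Ec`, `ι`, `Dt = {|Im τ| < s}`, `𝒢 := locE ∘ ℋ` with part 2's three output-chart binders, part 2's `hIm_realU1`, weights = tails with
equality) — so it APPLIES: `∀ h ∈ Window γ, ∀ k μν z, ∀ m ≤ k, ∀ᶠ K, ∃ Fc D, Fc holomorphic on D ∧ ‖Fc‖ ≤ C·e^{−δ₁|z|₁} ∧ discs ⊆ D ∧ Fc t = Π^{(K)}_{k+1}[localizedSum F S emb]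
(h|h_m:=t; z)`, `C = (16·(e·9·64·K₀(64,8)²·A e^{s})·B₃²∕r²)·e^{3·4M·δ₁}·K₀·K₁(4,δ₀∕2)`, `δ₁ = ½min{δ₀, κ∕(4M)}`.  §7 `exists_realU1Towers` (one term per polymer, `idx Z = {Z}`);
★★★ `exists_nondegenerate_realU1_windowedCouplingHolo` — PACKAGED with (C)'s admissible numerals (`κ = r₁ = 2κ₀(64,8)`, `R = r₁ + 128 log 162 + 2`,
`A = e^{−s}(2e^{5r₁+1}K₀(64,8)·9·64)⁻¹`): ∃ towers with (i) configuration-reading, (ii) coupling-reading, (iii) real terms, (iv) the datum `hA` for their localized sum.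

HONEST FRAMING (binding).  An A6 MODEL WITNESS (abelian toy on Bałaban's torus bookkeeping), count-neutral.  NOT NODE 00's tower, NOT the minimizer reading `U_{k+1}(e^{iB})`,
NOT print's chart `θ.ρ8`, NOT gauge-covariant; nothing of the record is claimed to meet anything; nothing of Bałaban's asserted or constructed ([I] = CMP 109 (1987) (1.7)
p. 261, p. 263, (1.18)–(1.21) p. 264, p. 282, (5.10) p. 293; [II] = CMP 116 (1988) (2.13)–(2.14) pp. 14–15, (2.38) p. 20 — TYPES only); N18's kernel step rate ∕ (1.21)
existence at this model NOT claimed (C2 §1 NOT fired); N22 NOT discharged (typed 28∕28 · discharged 5∕27 UNCHANGED — the chair's single count line is the only count); K3⁸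
OPEN, NOT claimed, no stub touched; one finite 𝕋⁴ programme at fixed ε — R4 closes the CONDITIONAL rung `BalabanLadder.UV` only; NOTHING about the continuum limit, ℝ⁴,
OS axioms, a mass gap or the Clay problem is proved or claimed by any of this.
-/

noncomputable section

open Filter Topology Set Metric
open scoped BigOperators

namespace YMDAG.N22.JointHoloLocalTerms.RealU1

open Literature.MathematicalPhysics.QuantumFieldTheory.Balaban1983to89
open Literature.MathematicalPhysics.QuantumFieldTheory.Balaban1983to89.T4Continuum (T4Family)
open Literature.MathematicalPhysics.QuantumFieldTheory.Balaban1983to89.T4OutputRate (Window)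
open Literature.MathematicalPhysics.QuantumFieldTheory.Balaban1983to89.Node00 (polWindow U3Letters₁₁)
open Literature.MathematicalPhysics.QuantumFieldTheory.Balaban1983to89.Node00.Sect2 (domCount domSys CPair)
open Literature.MathematicalPhysics.QuantumFieldTheory.Balaban1983to89.Node00.W1 (ClusterTower ClusterStep)
open Literature.MathematicalPhysics.QuantumFieldTheory.Balaban1983to89.Node00.U3OfKernels (histPrefix histPrefix_apply)
open Literature.MathematicalPhysics.QuantumFieldTheory.Balaban1983to89.Node00.LocalizedSum17 (localizedSum ReadingMaps)
open Literature.MathematicalPhysics.QuantumFieldTheory.Balaban1983to89.B13Resummation (locE)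
open Literature.MathematicalPhysics.QuantumFieldTheory.Balaban1983to89.B12TreeDecay (K₀ kappa₀ K₀_pos kappa₀_nonneg)
open Literature.MathematicalPhysics.QuantumFieldTheory.Balaban1983to89.B12Decay510 (delta1)
open Literature.MathematicalPhysics.QuantumFieldTheory.Balaban1983to89.B12Decay510Window (K₁)
open Literature.MathematicalPhysics.QuantumFieldTheory.Balaban1983to89.B12Decay510Torus (distCT nearT)
open Literature.MathematicalPhysics.QuantumFieldTheory.Balaban1983to89.B12Sec2to5 (l1)
open Literature.MathematicalPhysics.QuantumFieldTheory.Balaban1983to89.TreeLengthTorus (TPt TDom)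
open Literature.MathematicalPhysics.QuantumFieldTheory.Balaban1983to89.TreeLengthTorusGeometry (TTouch)
open Literature.MathematicalPhysics.QuantumFieldTheory.Balaban1983to89.B14.Eq22Determines (blockIter)
open Literature.MathematicalPhysics.QuantumFieldTheory.Balaban1983to89.B15DeterminingSets (embIter)
open YMDAG.N22.WindowSoftTwoPoint (smokeNumerals)
open YMDAG.N22.WindowSoftTwoPoint.NonzeroChart (tailWeight_pos tailWeight_mono norm_ι_single_le)
open YMDAG.N22.JointHoloLocalTerms (windowedCouplingHolo_localizedSum)
open YMDAG.N22.JointHolo (exists_exponent_rpow_le)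
open Literature.Analysis.Complex (isOpen_setOf_abs_im_lt)

/-! ## §6 C4 §2 FIRES AT THE REAL U(1) MODEL: the windowed coupling-holomorphy datum `hA` of the analytic kernel-fading road for the model's localized sum -/

section Tower

variable (F : T4Family) (M : ℕ) [NeZero M] (S : (K : ℕ) → ClusterTower (F.P K) ℂ M) {A R ω r δ₀ B₃ : ℝ}
variable (hS : ∀ (K k : ℕ) (g : Fin (k + 1) → ℝ) (φ : CPair (F.P K) ℂ) (Z : (domSys (F.P K) M (k + 1)).Dom),
  ((S K) k).H g φ Z = ((A * Real.exp (-(R * (domSys (F.P K) M (k + 1)).dj Z)) * Real.cos (∑ i : Fin (k + 1), g i * ω ^ (k + 1 - (i : ℕ))) : ℝ) : ℂ) *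
    (((Fintype.card (Fin (F.P K).d × Site (F.P K) (k + 1)) : ℂ))⁻¹ *
      ∑ lt : Fin (F.P K).d × Site (F.P K) (k + 1), ((Real.exp (-(r / (B₃ * Real.exp (-δ₀ * distCT (domCount (F.P K) M (k + 1)) M (fun i => (ZMod.cast (((blockIter (k + 1) (embIter (k + 1) lt.2))) i) : ZMod (domCount (F.P K) M (k + 1) * M))) (nearT (M := M) (fun i => (ZMod.cast (((blockIter (k + 1) (embIter (k + 1) lt.2))) i) : ZMod (domCount (F.P K) M (k + 1) * M))) Z))))) : ℝ) : ℂ) *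
        φ.1 ⟨embIter (k + 1) lt.2, lt.1⟩))
include hS

open Classical in
/-- ★★★ **C4 §2 FIRES AT THE REAL U(1) MODEL — THE WINDOWED COUPLING-HOLOMORPHY DATUM `hA` OF `…N22KernelFadingOfStepRateTwoConstants` §1 FOR node00-def-W1's LOCALIZED SUM OF
ACTIVITY-LEVEL TOWERS THAT READ THE CONFIGURATION AND EVERY COUPLING.**  Cube side `M = L^{m′}`; towers `S` whose activities ARE the real U(1) display; window `γ > 0`;
field radius = the model's read-out letter `r > 0`; tails `δ₀ > 0`, `B₃ > 0`; `0 ≤ A`, `0 ≤ ω ≤ 1`; soft-sum rate `κ` with `2κ₀(64,8) ≤ κ ≤ r₁`; Road 1's numerals for the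
amplitude `A e^{s}` (`0 ≤ r₁`, `r₁ + 128 log 162 + 2 ≤ R`, `A e^{s}e^{5r₁+1}K₀(64,8)·9·64 ≤ 1`); disc radius `0 ≤ r₀ < s`.  THEN ALL hypotheses of C4 §2
`windowedCouplingHolo_localizedSum` (p629756) hold at: `S`, the reading `emb K k W = (b ↦ ½(W_{b.dir}(t_b) + W_{b.dir}(t_b)⁻¹), 0)`, the chart `x ↦ ix`, the singleton basis,
`Ec K k = (Fin d → Site_{k+1} → ℂ)`, dag-n22-w2's injective tail-weight complexification `ι`, `Dt = {|Im τ| < s}`, the per-term joint OUTPUT charts `𝒢 := locE ∘ ℋ` of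
part 2's `jointCharts_of_activityJointCharts_fires_realU1` (their three binders), the reality binder (part 2 `hIm_realU1`), the site weights = the p. 282 tails (dag-n22-w2's
`norm_ι_single_le`, `htail` with equality) — so it APPLIES and returns, for every window history `h`, level `k`, entry `(μν, z)` and young coupling `m ≤ k`, EVENTUALLY IN `K`:
`∃ Fc D, Fc holomorphic on D ∧ ‖Fc‖ ≤ C·e^{−δ₁|z|₁} on D ∧ the closed r₀-discs about ]0,γ] ⊆ D ∧ Fc t = Π^{(K)}_{k+1}[localizedSum F S emb](h|h_m:=t; z)`,
`C = (16·(e·9·64·K₀(64,8)²·A e^{s})·B₃²∕r²)·e^{3·4M·δ₁}·K₀(64,8)·K₁(4,δ₀∕2)`, `δ₁ = ½min{δ₀, κ(4M)⁻¹}` — LITERALLY C2's binder `hA` at `ℰ := localizedSum F S emb`, on a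
NON-DEGENERATE activity-level model (part 1 `H_reads_config_realU1` ∕ `H_update_realU1`, part 2 §4b).  MODEL witness (declared): NOT NODE 00's towers; C2 §1's other binders
(N18's kernel step rate, (1.21) existence) are NOT claimed here. [folklore] -/
theorem windowedCouplingHolo_localizedSum_fires_realU1 (m' : ℕ) (hM : M = F.L ^ m') {γ κ s r₀ r₁ : ℝ} (hγ : 0 < γ) (hr : 0 < r)
    (hκ₀ : kappa₀ (4 * 2 ^ 4) (2 * 4) ≤ κ / 2) (hδ₀ : 0 < δ₀) (hB₃ : 0 < B₃) (hA : 0 ≤ A) (hω0 : 0 ≤ ω) (hω1 : ω ≤ 1) (hκE : κ ≤ r₁)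
    (hr₁ : 0 ≤ r₁) (hrate : r₁ + 2 * (64 * Real.log 162) + 2 ≤ R) (hsmall : A * Real.exp s * Real.exp (5 * r₁ + 1) * K₀ 64 8 * 9 * 64 ≤ 1)
    (hr₀ : 0 ≤ r₀) (hr₀s : r₀ < s) :
    ∀ h ∈ Window γ, ∀ (k : ℕ) (μ ν : Fin 4) (z : Fin 4 → ℤ) (m : ℕ), m < k + 1 → ∀ᶠ K in atTop,
      ∃ (Fc : ℂ → ℂ) (D : Set ℂ), DifferentiableOn ℂ Fc D ∧
        (∀ w' ∈ D, ‖Fc w'‖ ≤ (16 * (Real.exp 1 * 9 * 64 * K₀ 64 8 ^ 2 * (A * Real.exp s)) * B₃ ^ 2 / r ^ 2) *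
            Real.exp (delta1 δ₀ κ ((M : ℝ) * 4) * ((M : ℝ) * 4) * 3) * K₀ (4 * 2 ^ 4) (2 * 4) * K₁ 4 (δ₀ / 2) * Real.exp (-(delta1 δ₀ κ ((M : ℝ) * 4) * l1 z))) ∧
        (∀ t ∈ Ioc (0 : ℝ) γ, closedBall (t : ℂ) r₀ ⊆ D) ∧
        (∀ t ∈ Ioc (0 : ℝ) γ, Fc t = (polWindow F K (k + 1) (localizedSum F S
            (fun (K k : ℕ) (W : Fin (F.P K).d → Site (F.P K) (k + 1) → ℂ) =>
        (((fun b : PBond (F.P K) 0 => (W b.dir (blockIter (k + 1) b.src) + (W b.dir (blockIter (k + 1) b.src))⁻¹) / 2), fun _ => (0 : ℂ)) : CPair (F.P K) ℂ))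
            k (histPrefix (Function.update h m t) k) K) ((ContinuousLinearMap.id ℝ ℝ).smulRight Complex.I) (Module.Basis.singleton Unit ℝ) μ ν z : ℂ)) := by
  obtain ⟨h𝒢, hM𝒢, hf⟩ := jointCharts_of_activityJointCharts_fires_realU1 F M S hS γ s hA hω0 hω1 hδ₀.le hB₃ hr₁ hrate hsmall
  have hB : 0 ≤ Real.exp 1 * 9 * 64 * K₀ 64 8 ^ 2 * (A * Real.exp s) := by have := K₀_pos 64 8; positivity
  refine windowedCouplingHolo_localizedSum F m' M hM S
    (fun (K k : ℕ) (W : Fin (F.P K).d → Site (F.P K) (k + 1) → ℂ) =>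
        (((fun b : PBond (F.P K) 0 => (W b.dir (blockIter (k + 1) b.src) + (W b.dir (blockIter (k + 1) b.src))⁻¹) / 2), fun _ => (0 : ℂ)) : CPair (F.P K) ℂ))
    ((ContinuousLinearMap.id ℝ ℝ).smulRight Complex.I) (Module.Basis.singleton Unit ℝ) hγ hr hκ₀ hδ₀ hB₃.le hB hκE
    (fun K k => Fin (F.P K).d → Site (F.P K) (k + 1) → ℂ)
    (fun (K k : ℕ) (X : (domSys (F.P K) M (k + 1)).Dom) => (LinearMap.toContinuousLinearMap
      { toFun := fun B : Fin (F.P K).d → Site (F.P K) (k + 1) → ℝ => fun l t => ((B l t : ℝ) : ℂ) * (((B₃ * Real.exp (-δ₀ * distCT (domCount (F.P K) M (k + 1)) M (fun i => (ZMod.cast ((t) i) : ZMod (domCount (F.P K) M (k + 1) * M))) (nearT (M := M) (fun i => (ZMod.cast ((t) i) : ZMod (domCount (F.P K) M (k + 1) * M))) X))) : ℝ) : ℂ)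
        map_add' := fun B B' => by funext l t; simp only [Pi.add_apply]; push_cast; ring
        map_smul' := fun c B => by funext l t; simp only [Pi.smul_apply, smul_eq_mul, RingHom.id_apply, Complex.real_smul]; push_cast; ring } :
      (Fin (F.P K).d → Site (F.P K) (k + 1) → ℝ) →L[ℝ] (Fin (F.P K).d → Site (F.P K) (k + 1) → ℂ)))
    (isOpen_setOf_abs_im_lt s) (fun t _ => closedBall_ofReal_subset_strip t hr₀s) hr₀
    (fun (K k : ℕ) (h : ℕ → ℝ) (m : ℕ) (X : (domSys (F.P K) M (k + 1)).Dom) (p : ℂ × (Fin (F.P K).d → Site (F.P K) (k + 1) → ℂ)) =>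
      locE (TTouch (d := 4) (N := domCount (F.P K) M (k + 1))) (fun Z : (domSys (F.P K) M (k + 1)).Dom => Z.1)
        (fun Z => (fun (K k : ℕ) (h : ℕ → ℝ) (m : ℕ) (X Z : (domSys (F.P K) M (k + 1)).Dom) (p : ℂ × (Fin (F.P K).d → Site (F.P K) (k + 1) → ℂ)) =>
        ((A * Real.exp (-(R * (domSys (F.P K) M (k + 1)).dj Z)) : ℝ) : ℂ) *
            Complex.cos (((∑ j : Fin (k + 1), histPrefix (Function.update h m 0) k j * ω ^ (k + 1 - (j : ℕ)) : ℝ) : ℂ) +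
              p.1 * ((if m < k + 1 then ω ^ (k + 1 - m) else 0 : ℝ) : ℂ)) *
          (((Fintype.card (Fin (F.P K).d × Site (F.P K) (k + 1)) : ℂ))⁻¹ *
            ∑ lt : Fin (F.P K).d × Site (F.P K) (k + 1), ((Real.exp (-(r / (B₃ * Real.exp (-δ₀ * distCT (domCount (F.P K) M (k + 1)) M (fun i => (ZMod.cast (((blockIter (k + 1) (embIter (k + 1) lt.2))) i) : ZMod (domCount (F.P K) M (k + 1) * M))) (nearT (M := M) (fun i => (ZMod.cast (((blockIter (k + 1) (embIter (k + 1) lt.2))) i) : ZMod (domCount (F.P K) M (k + 1) * M))) Z))))) : ℝ) : ℂ) *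
              Complex.cos (p.2 lt.1 (blockIter (k + 1) (embIter (k + 1) lt.2)) / (((B₃ * Real.exp (-δ₀ * distCT (domCount (F.P K) M (k + 1)) M (fun i => (ZMod.cast (((blockIter (k + 1) (embIter (k + 1) lt.2))) i) : ZMod (domCount (F.P K) M (k + 1) * M))) (nearT (M := M) (fun i => (ZMod.cast (((blockIter (k + 1) (embIter (k + 1) lt.2))) i) : ZMod (domCount (F.P K) M (k + 1) * M))) X))) : ℝ) : ℂ)))) K k h m X Z p) X.1)
    h𝒢 hM𝒢 hf (hIm_realU1 F M S hS γ)
    (fun (K k : ℕ) (X : (domSys (F.P K) M (k + 1)).Dom) (t : Site (F.P K) (k + 1)) => (B₃ * Real.exp (-δ₀ * distCT (domCount (F.P K) M (k + 1)) M (fun i => (ZMod.cast ((t) i) : ZMod (domCount (F.P K) M (k + 1) * M))) (nearT (M := M) (fun i => (ZMod.cast ((t) i) : ZMod (domCount (F.P K) M (k + 1) * M))) X))))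
    (fun K k X t => (tailWeight_pos _ X hB₃).le) ?_ (fun K k X t => le_rfl)
  intro K k X l t c
  rw [LinearMap.coe_toContinuousLinearMap']
  exact norm_ι_single_le _ (fun t => (tailWeight_pos _ X hB₃).le) l t c

end Tower

/-! ## §7 Realisation of the real U(1) towers (one term per polymer) and the PACKAGED non-degenerate witness with admissible numerals -/

section Realise

variable (F : T4Family) (M : ℕ) [NeZero M]

/-- **THE REAL U(1) MODEL TOWERS EXIST** with exactly the prescribed activities (index type `𝐃_{k+1}`, `idx Z = {Z}`: ONE multi-index per polymer), on every torus `K` and level `k`,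
for any letters. [folklore] -/
theorem exists_realU1Towers (A R ω r δ₀ B₃ : ℝ) :
    ∃ S : (K : ℕ) → ClusterTower (F.P K) ℂ M, ∀ (K k : ℕ) (g : Fin (k + 1) → ℝ) (φ : CPair (F.P K) ℂ) (Z : (domSys (F.P K) M (k + 1)).Dom),
      ((S K) k).H g φ Z = ((A * Real.exp (-(R * (domSys (F.P K) M (k + 1)).dj Z)) * Real.cos (∑ i : Fin (k + 1), g i * ω ^ (k + 1 - (i : ℕ))) : ℝ) : ℂ) *
    (((Fintype.card (Fin (F.P K).d × Site (F.P K) (k + 1)) : ℂ))⁻¹ *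
      ∑ lt : Fin (F.P K).d × Site (F.P K) (k + 1), ((Real.exp (-(r / (B₃ * Real.exp (-δ₀ * distCT (domCount (F.P K) M (k + 1)) M (fun i => (ZMod.cast (((blockIter (k + 1) (embIter (k + 1) lt.2))) i) : ZMod (domCount (F.P K) M (k + 1) * M))) (nearT (M := M) (fun i => (ZMod.cast (((blockIter (k + 1) (embIter (k + 1) lt.2))) i) : ZMod (domCount (F.P K) M (k + 1) * M))) Z))))) : ℝ) : ℂ) *
        φ.1 ⟨embIter (k + 1) lt.2, lt.1⟩) :=
  ⟨fun K k => ⟨(domSys (F.P K) M (k + 1)).Dom, fun Z => {Z}, fun Z g φ => ((A * Real.exp (-(R * (domSys (F.P K) M (k + 1)).dj Z)) * Real.cos (∑ i : Fin (k + 1), g i * ω ^ (k + 1 - (i : ℕ))) : ℝ) : ℂ) *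
    (((Fintype.card (Fin (F.P K).d × Site (F.P K) (k + 1)) : ℂ))⁻¹ *
      ∑ lt : Fin (F.P K).d × Site (F.P K) (k + 1), ((Real.exp (-(r / (B₃ * Real.exp (-δ₀ * distCT (domCount (F.P K) M (k + 1)) M (fun i => (ZMod.cast (((blockIter (k + 1) (embIter (k + 1) lt.2))) i) : ZMod (domCount (F.P K) M (k + 1) * M))) (nearT (M := M) (fun i => (ZMod.cast (((blockIter (k + 1) (embIter (k + 1) lt.2))) i) : ZMod (domCount (F.P K) M (k + 1) * M))) Z))))) : ℝ) : ℂ) *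
        φ.1 ⟨embIter (k + 1) lt.2, lt.1⟩)⟩,
    fun K k g φ Z => by simp only [ClusterStep.H, Finset.sum_singleton]⟩

open Classical in
/-- ★★★ **PACKAGED — THE ACTIVITY-LEVEL A6 OF THE ANALYTIC ROAD.**  For every family `F`, cube side `M = L^{m′}`, window `γ > 0`, tails `δ₀ > 0`, `B₃ > 0`, read-out radius
`r > 0`, fading ratio `0 < ω ≤ 1`, strip data `0 ≤ r₀ < s`: with (C)'s admissible numerals `κ = r₁ = 2κ₀(64,8)`, `R = r₁ + 128 log 162 + 2`,
`A = e^{−s}·(2e^{5r₁+1}K₀(64,8)·9·64)⁻¹` (`smokeNumerals`) THERE ARE towers `S` on every torus whose activities (i) VANISH at the zero configuration and are NON-ZERO at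
the unit one (they READ the configuration), (ii) carry a genuine cosine phase in EVERY young coupling (`H(Z; g|g_i:=s′) = A e^{−Rd}cos(a_i(g) + s′ω^{k+1−i})·readout`),
(iii) have REAL (2.13) terms at real data read through `emb` after the chart `x ↦ ix`, AND (iv) for which C2's windowed coupling-holomorphy datum `hA` HOLDS for
`ℰ := localizedSum F S emb` (§6) — the antecedent of the analytic kernel-fading road inhabited at the ACTIVITY level, non-degenerately.  MODEL witness (declared) — NOT NODE
00's towers; N18's kernel step rate ∕ (1.21) existence NOT claimed; nothing of the record is claimed. [folklore] -/
theorem exists_nondegenerate_realU1_windowedCouplingHolo (m' : ℕ) (hM : M = F.L ^ m') {γ ω r δ₀ B₃ r₀ s : ℝ} (hγ : 0 < γ) (hω0 : 0 < ω) (hω1 : ω ≤ 1)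
    (hr : 0 < r) (hδ₀ : 0 < δ₀) (hB₃ : 0 < B₃) (hr₀ : 0 ≤ r₀) (hr₀s : r₀ < s) :
    ∃ (S : (K : ℕ) → ClusterTower (F.P K) ℂ M) (A R : ℝ), 0 < A ∧
      (∀ (K k : ℕ) (g : Fin (k + 1) → ℝ) (Z : (domSys (F.P K) M (k + 1)).Dom),
        ((S K) k).H g (0 : CPair (F.P K) ℂ) Z = 0 ∧ 0 < ‖((S K) k).H (fun _ => 0) ((fun _ => (1 : ℂ)), fun _ => (0 : ℂ)) Z‖) ∧
      (∀ (K k : ℕ) (g : Fin (k + 1) → ℝ) (φ : CPair (F.P K) ℂ) (Z : (domSys (F.P K) M (k + 1)).Dom) (i : Fin (k + 1)) (s' : ℝ),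
        ((S K) k).H (Function.update g i s') φ Z =
          ((A * Real.exp (-(R * (domSys (F.P K) M (k + 1)).dj Z)) *
              Real.cos (∑ j : Fin (k + 1), Function.update g i 0 j * ω ^ (k + 1 - (j : ℕ)) + s' * ω ^ (k + 1 - (i : ℕ))) : ℝ) : ℂ) *
            (((Fintype.card (Fin (F.P K).d × Site (F.P K) (k + 1)) : ℂ))⁻¹ *
              ∑ lt : Fin (F.P K).d × Site (F.P K) (k + 1), ((Real.exp (-(r / (B₃ * Real.exp (-δ₀ * distCT (domCount (F.P K) M (k + 1)) M (fun i => (ZMod.cast (((blockIter (k + 1) (embIter (k + 1) lt.2))) i) : ZMod (domCount (F.P K) M (k + 1) * M))) (nearT (M := M) (fun i => (ZMod.cast (((blockIter (k + 1) (embIter (k + 1) lt.2))) i) : ZMod (domCount (F.P K) M (k + 1) * M))) Z))))) : ℝ) : ℂ) *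
                φ.1 ⟨embIter (k + 1) lt.2, lt.1⟩)) ∧
      (∀ (K k : ℕ), ∀ h ∈ Window γ, ∀ (m : ℕ) (X : (domSys (F.P K) M (k + 1)).Dom), ∀ t ∈ Ioc (0 : ℝ) γ,
        ∀ Bf : Fin (F.P K).d → Site (F.P K) (k + 1) → ℝ,
          (((S K) k).E (histPrefix (Function.update h m t) k)
              ((fun (K k : ℕ) (W : Fin (F.P K).d → Site (F.P K) (k + 1) → ℂ) =>
        (((fun b : PBond (F.P K) 0 => (W b.dir (blockIter (k + 1) b.src) + (W b.dir (blockIter (k + 1) b.src))⁻¹) / 2), fun _ => (0 : ℂ)) : CPair (F.P K) ℂ)) K k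
                (fun l u => NormedSpace.exp (((ContinuousLinearMap.id ℝ ℝ).smulRight Complex.I) (Bf l u)))) X).im = 0) ∧
      (∀ h ∈ Window γ, ∀ (k : ℕ) (μ ν : Fin 4) (z : Fin 4 → ℤ) (m : ℕ), m < k + 1 → ∀ᶠ K in atTop,
      ∃ (Fc : ℂ → ℂ) (D : Set ℂ), DifferentiableOn ℂ Fc D ∧
        (∀ w' ∈ D, ‖Fc w'‖ ≤ (16 * (Real.exp 1 * 9 * 64 * K₀ 64 8 ^ 2 * (A * Real.exp s)) * B₃ ^ 2 / r ^ 2) *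
            Real.exp (delta1 δ₀ (2 * kappa₀ (4 * 2 ^ 4) (2 * 4)) ((M : ℝ) * 4) * ((M : ℝ) * 4) * 3) * K₀ (4 * 2 ^ 4) (2 * 4) * K₁ 4 (δ₀ / 2) * Real.exp (-(delta1 δ₀ (2 * kappa₀ (4 * 2 ^ 4) (2 * 4)) ((M : ℝ) * 4) * l1 z))) ∧
        (∀ t ∈ Ioc (0 : ℝ) γ, closedBall (t : ℂ) r₀ ⊆ D) ∧
        (∀ t ∈ Ioc (0 : ℝ) γ, Fc t = (polWindow F K (k + 1) (localizedSum F S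
            (fun (K k : ℕ) (W : Fin (F.P K).d → Site (F.P K) (k + 1) → ℂ) =>
        (((fun b : PBond (F.P K) 0 => (W b.dir (blockIter (k + 1) b.src) + (W b.dir (blockIter (k + 1) b.src))⁻¹) / 2), fun _ => (0 : ℂ)) : CPair (F.P K) ℂ))
            k (histPrefix (Function.update h m t) k) K) ((ContinuousLinearMap.id ℝ ℝ).smulRight Complex.I) (Module.Basis.singleton Unit ℝ) μ ν z : ℂ))) := by
  obtain ⟨hA₀, hκ, hκ₀, hsmall⟩ := smokeNumerals
  set A₀ : ℝ := 1 / (2 * Real.exp (5 * (2 * kappa₀ (4 * 2 ^ 4) (2 * 4)) + 1) * K₀ 64 8 * 9 * 64) with hA₀def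
  obtain ⟨S, hS⟩ := exists_realU1Towers F M (A₀ * Real.exp (-s)) (2 * kappa₀ (4 * 2 ^ 4) (2 * 4) + 2 * (64 * Real.log 162) + 2) ω r δ₀ B₃
  have hAs : A₀ * Real.exp (-s) * Real.exp s = A₀ := by rw [mul_assoc, ← Real.exp_add, neg_add_cancel, Real.exp_zero, mul_one]
  have hsmall1 : A₀ * Real.exp (-s) * Real.exp s * Real.exp (5 * (2 * kappa₀ (4 * 2 ^ 4) (2 * 4)) + 1) * K₀ 64 8 * 9 * 64 ≤ 1 := by
    rw [hAs]
    have h0 : 0 ≤ A₀ * Real.exp (5 * (2 * kappa₀ (4 * 2 ^ 4) (2 * 4)) + 1) * K₀ 64 8 * 9 * 64 := by have := K₀_pos 64 8; positivity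
    nlinarith
  let wt : (K k : ℕ) → (domSys (F.P K) M (k + 1)).Dom → Site (F.P K) (k + 1) → ℝ := fun K k X t =>
    (B₃ * Real.exp (-δ₀ * distCT (domCount (F.P K) M (k + 1)) M (fun i => (ZMod.cast ((t) i) : ZMod (domCount (F.P K) M (k + 1) * M))) (nearT (M := M) (fun i => (ZMod.cast ((t) i) : ZMod (domCount (F.P K) M (k + 1) * M))) X)))
  refine ⟨S, A₀ * Real.exp (-s), 2 * kappa₀ (4 * 2 ^ 4) (2 * 4) + 2 * (64 * Real.log 162) + 2, by positivity, fun K k g Z => ?_,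
    fun K k g φ Z i s' => H_update_realU1 ((S K) k) (wt K k) (hS K k) g φ Z i s', hIm_realU1 F M S hS γ, ?_⟩
  · haveI : Nonempty (Fin (F.P K).d × Site (F.P K) (k + 1)) := ⟨(⟨0, by simp⟩, fun _ => 0)⟩
    exact H_reads_config_realU1 ((S K) k) (wt K k) (hS K k) (by positivity) g Z
  · have h := windowedCouplingHolo_localizedSum_fires_realU1 F M S hS m' hM (κ := 2 * kappa₀ (4 * 2 ^ 4) (2 * 4)) (s := s) (r₀ := r₀)
      (r₁ := 2 * kappa₀ (4 * 2 ^ 4) (2 * 4)) hγ hr hκ₀ hδ₀ hB₃ (by positivity) hω0.le hω1 le_rfl hκ le_rfl hsmall1 hr₀ hr₀s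
    exact h

end Realise

/-! ## §8 The LETTER ROWS of the analytic road's record theorems (C2 §2 ∕ C4 §3 ∕ C6 §3) are JOINTLY SATISFIABLE with `ℓ.Signs` for EVERY rate `ω ∈ ]θ₅, 1[` -/

section Rows

/-- ★ **THE ROWS OF THE ANALYTIC ROAD ARE NOT DEGENERATE-ONLY.**  For every NE5 rate `θ₅ ∈ ]0, 1[`, NE5 constant `C₅ ≥ 0`, EVERY fading rate `ω ∈ ]θ₅, 1[`, every decay target
`δ₁ ≥ 0` and ANY right-hand side `f` for the `C₉`-row (in C2 §2 ∕ C4 §3 ∕ C6 §3: `f s = 32∕(s²·min(r₀∕2, γ∕2))·(2C₀)^{1−s}(2C₂ + C₀)^{s}∕θ₅^{1−s}`), there are an exponent `s ∈ ]0, 1[`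
(C3 §5 `JointHolo.exists_exponent_rpow_le`) and a letter block `ℓ : U3Letters₁₁` WITH `ℓ.Signs`, `ℓ.θ₅ = θ₅`, `ℓ.C₅ = C₅`, `ℓ.ω = ω` satisfying ALL displayed rows: `ℓ.θ₅^{1−s} ≤ ℓ.ω`, `ℓ.κ ≤ δ₁`, `f s ≤ ℓ.C₉` — the analytic
road books EXACTLY `θ₅ < ω` (cf. `…N22KnitRoadRatesSharpTwoConstants`: `θ₅ < ω` is also necessary at models), where the second-difference road books `θ₅ ≤ ω²` (J42 §2
`exists_letterBlock_rows`). [folklore] -/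
theorem exists_letterBlock_rows_twoConstants {θ₅ ω C₅ δ₁ : ℝ} (hθ0 : 0 < θ₅) (hθω : θ₅ < ω) (hω1 : ω < 1) (hC₅ : 0 ≤ C₅) (hδ₁ : 0 ≤ δ₁) (f : ℝ → ℝ) :
    ∃ (s : ℝ) (ℓ : U3Letters₁₁), ℓ.Signs ∧ ℓ.θ₅ = θ₅ ∧ ℓ.C₅ = C₅ ∧ ℓ.ω = ω ∧ 0 < s ∧ s < 1 ∧ ℓ.θ₅ ^ (1 - s) ≤ ℓ.ω ∧ ℓ.κ ≤ δ₁ ∧ f s ≤ ℓ.C₉ := by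
  obtain ⟨s, hs0, hs1, hse⟩ := exists_exponent_rpow_le hθ0 hθω hω1
  have hω0 : 0 ≤ ω := (hθ0.trans hθω).le
  refine ⟨s, { κ := 0, θ₅ := θ₅, C₅ := C₅, C₉ := max (f s) 0, ω := ω, cr := 0, ρ := ω }, ?_, rfl, rfl, rfl, hs0, hs1, hse, hδ₁, le_max_left _ _⟩
  exact { κ_nonneg := le_rfl, θ₅_pos := hθ0, θ₅_lt_one := hθω.trans hω1, C₅_nonneg := hC₅, C₉_nonneg := le_max_right _ _, ω_nonneg := hω0, ω_lt_one := hω1,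
          cr_nonneg := le_rfl, θ₅_le_ρ := hθω.le, ω_le_ρ := le_rfl, ρ_lt_one := hω1 }

end Rows

end YMDAG.N22.JointHoloLocalTerms.RealU1

end
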